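import Summits.CriticalPhenomena.CardyFormulaZ2.Theses.CardySusyWard
import Summits.CriticalPhenomena.CardyFormulaZ2.Theorems.ParafermionPrecompact.Negative.ParafermionPrecompactFalseOfBulkNondegenerate

/-!
# Skeleton line `exact-potential-schwarz-christoffel` for the crux `ParafermionFamiliesToSLESix`
(stmt-CriticalPhenomena-10814, route `CardySusyWard`, rank 4)

Crux (fixed, by name):
`ParafermionFamiliesToSLESix : WeakHolomorphy → ParafermionPrecompact → AllFamiliesSLE6`
(SLE₆ for every Dobrushin domain and every admissible square-lattice discretisation family;
`crux_unfold` below is `Iff.rfl`).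

Idea (card `Ideas/exact-potential-schwarz-christoffel.md`, ideator 1; triage r1-1/2/3 pass):
INTEGRATE `F`, NOT `F²`.  The `q = 1` corner (= medial-edge) parafermionic form of the
exploration interface is EXACTLY closed at every inner medial vertex (Duminil-Copin 2012,
Prop. 4 — the divergence half of discrete Cauchy–Riemann, the technique class
`halfCRSolutions` of the barrier `FKParafermionicHalfCauchyRiemann(Narrow)`), hence has an exact
face potential `H_δ` (vertex part `H•`, face part `H∘`); on the free arc its increments are
(deterministic unit phase) × `P(x ↔ A)` (DC 2012, Prop. 5), so the boundary trace of
`Ĥ_δ = δ^{2/3} H_δ` is piecewise COLLINEAR and MONOTONE.  The fixed-domain identification of the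
crux is then: precompactness of `Ĥ_δ` up to the boundary (Koebe envelope), holomorphy of the
limit, and SCHWARZ–CHRISTOFFEL RIGIDITY of bounded holomorphic functions on the strip with
monotone piecewise-collinear traces (`stub_scRigidity`, pure complex analysis) — the limit is
`c · h_P + const`, `c ≥ 0` REAL by positivity, and the normalised free-arc touch counts follow the
SC boundary weight `|Φ_P′|^{1/3} |dz|` in RATIO (no amplitude convergence is claimed or needed).
The dynamic step (touch-intensity law on rectilinear polygons ⇒ SLE₆ for all families: the
Kemppainen–Smirnov/positivity sandwich of the sister cards `free-arc-touch-covariance-martingale`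
≈ `six-arm-collar-compensator`) is the delegated last stub.

PLANNER'S FINDING while cutting the stubs (recorded in the line card, §Hardest stub): exact
closedness + the crux's VERTEX-level `WeakHolomorphy` make every subsequential limit of the
potential complex-HARMONIC (`h = H₁ + conj H₂`), not holomorphic; holomorphy of the potential is
the Duffin relation `F_B = (1 - i) F_A + i F_D` between the corner classes at each medial vertex —
the genuinely missing dual half at CORNER level.  It is isolated as `stub_antiholomorphicDefect`
(`X1 →` weak holomorphy of the vertex potential), so that the gap between the route's rank-2 crux
and what the potential method consumes is a named stub and not hidden in the identification.

Disproof.lean (cdisprove cycle 1) honoured: no `_false_without_` theorem exists for this crux; the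
typed second hypothesis collapses (`parafermionPrecompact_iff_vanishing`), and this line NEVER
uses the vacuous branch (`crux_of_not_vanishing` / `crux_of_bulkNondegenerate`): the composition
consumes `ParafermionPrecompact` only through the landed weakening
`repaired_of_parafermionPrecompact` (edge-guarded `ParafermionPrecompactRepairedAt`, Negative
lemma file of stmt-11293), so it survives the announced edge-guard repair of 11293 verbatim; every
lattice quantifier below runs over genuine lattice objects (corners of inner faces, edges of
`Ω_δ`, sites of the discrete arcs) — the junk-twin witnesses of the negatives index (stmt-6949,
0748/0772, 11293) do not apply; every family keeps all six `IsFamily` fields incl. eventual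
admissibility and marks (refuted strengthenings S1/S1′ of Disproof §4–4′).

Composition: `allFamiliesSLE6_of_stubs : S1 → … → S7 → (the crux unfolded)` is pure logic
(sorry-free, axiom-free beyond the standard three); `ParafermionFamiliesToSLESix_of : <crux decl>`
applies it to the seven registered `stub_*` theorems (the only `sorry`s of the file) and is the
unique theorem of the file concluding the crux by name.
-/

noncomputable section

namespace Summit.CriticalPhenomena.CardyFormulaZ2.Cruxes.ParafermionFamiliesToSLESix.ExactPotentialSchwarzChristoffel

open scoped Topology
open Filter Set MeasureTheory
open UpperHalfPlane (upperHalfPlaneSet)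
open Literature.Probability.LatticeModels Literature.Probability.Percolation
open Literature.Probability.RandomPlanarGeometry
open Summit.CriticalPhenomena.CardyFormulaZ2.Theses.CardySusyWard (WeakHolomorphy ParafermionPrecompact
  ParafermionFamiliesToSLESix)
open Summit.CriticalPhenomena.CardyFormulaZ2.Theorems.ParafermionPrecompact.Negative (IsFamily
  ParafermionPrecompactRepairedAt repaired_of_parafermionPrecompact)

/-! ## 0. Vocabulary (local abbreviations over existing declarations) -/

/-- The unit lattice vectors `e₀ = (1,0)`, `e₁ = (0,1)` of `ℤ²`. -/
def e0 : Site 2 := Pi.single 0 1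
/-- See `e0`. -/
def e1 : Site 2 := Pi.single 1 1

/-- Contribution of one medial path `γ` (mesh `δ`, spin `spin`) to the CORNER (= medial-edge,
dart) parafermionic observable at the corner `(v, f)` (vertex `v` on the left, face `f`): the sum
over the positions `k` at which `γ` traverses the dart `cornerSource v f → cornerTarget v f` of
`exp (-i · spin · W)`, `W` the winding of the polyline prefix ending with that dart — verbatim
the corner observable `E_δ(v,f)` of route `CardyComplexCone` / card `strip-anchored-vertex-normalisation`. -/
def cornerPassageSum (γ : List MedialVertex) (δ spin : ℝ) (v f : Site 2) : ℂ :=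
  ∑ k ∈ (Finset.range γ.length).filter
      (fun k => γ[k]? = some (cornerSource v f) ∧ γ[k + 1]? = some (cornerTarget v f)),
    Complex.exp (-Complex.I * spin * ((Polyline.winding ((γ.map (medialPoint δ)).take (k + 2)) : ℝ) : ℂ))

/-- The expected spin-`1/3` corner observable `F_δ(v,f)` of the exploration interface of the
discrete Dobrushin datum `E` under `P_{1/2}` (bond percolation on `ℤ²`). -/
def cornerObs (E : DiscreteDobrushin) (v f : Site 2) : ℂ :=
  ∫ ω, cornerPassageSum (medialExploration E ω) E.δ (1 / 3) v f ∂(bondPercolation (zdGraph 2) half)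

/-- Unit direction `τ(v,f)` of the dart `(v,f)` (from the midpoint of `cornerSource` to the midpoint
of `cornerTarget`; the medial edge has length `1/√2` at mesh `1`).  The corner FLOW is
`J(v,f) = F(v,f) · τ(v,f)`; DC's vertex relation says `J` is divergence-free, and the face
potential `(H•, H∘)` is its stream function: `H•(v) - H∘(f) = J(v,f)`. -/
def dir (v f : Site 2) : ℂ :=
  (medialPoint 1 (cornerTarget v f) - medialPoint 1 (cornerSource v f)) * (Real.sqrt 2 : ℂ)

/-- `P_{1/2}[x ↔ A]`: the site `x` is joined to the discrete wired arc by edges that are open in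
the boundary-condition-completed configuration `E.bcBondConfig ω`. -/
def connA (E : DiscreteDobrushin) (x : Site 2) : ℝ :=
  (bondPercolation (zdGraph 2) half).real
    {ω | ∃ a ∈ E.zdArcA, (openGraph (E.bcBondConfig ω)).Reachable x a}

/-- `P_{1/2}[the exploration path traverses the dart (v,f)]`. -/
def dartProb (E : DiscreteDobrushin) (v f : Site 2) : ℝ :=
  (bondPercolation (zdGraph 2) half).real
    {ω | ∃ k : ℕ, (medialExploration E ω)[k]? = some (cornerSource v f) ∧
      (medialExploration E ω)[k + 1]? = some (cornerTarget v f)}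

/-- The corner weight of the dart `(v,f)` in the ALL-OPEN configuration (whose exploration path hugs
the dual-wired arc `B`): the deterministic phase of the free-arc boundary darts. -/
def openPhase (E : DiscreteDobrushin) (v f : Site 2) : ℂ :=
  cornerPassageSum (medialExploration E (Set.univ : BondConfig (Site 2))) E.δ (1 / 3) v f

/-- The corner weight of the dart `(v,f)` in the ALL-CLOSED configuration (whose exploration path
hugs the wired arc `A`): the deterministic phase of the wired-arc boundary darts. -/
def closedPhase (E : DiscreteDobrushin) (v f : Site 2) : ℂ :=
  cornerPassageSum (medialExploration E (∅ : BondConfig (Site 2))) E.δ (1 / 3) v f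

/-- Normalisable free-arc TOUCH COUNT of the window `W ⊆ ℂ`: the expected number of
free-arc-adjacent sites `x` (off both discrete arcs, with an `Ω_δ`-neighbour on the dual-wired arc)
whose mesh point lies in `W` and which are joined to the wired arc, `Σ_x P[x ↔ A]` — by clause (c)
of `CornerFormStructure` the total variation of the boundary trace of the potential over `W`. -/
def touchCount (E : DiscreteDobrushin) (W : Set ℂ) : ℝ :=
  ∑ᶠ x : Site 2, Set.indicator
    {x : Site 2 | x ∉ E.zdArcA ∧ x ∉ E.zdArcB ∧
      (∃ y ∈ E.zdArcB, s(x, y) ∈ (discreteDomainGraph E.Ω E.δ).edgeSet) ∧ meshPoint E.δ x ∈ W}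
    (connA E) x

/-- Rectilinear Dobrushin polygons: the Jordan boundary lies in finitely many axis-parallel
segments (marks anywhere; verbatim the hypothesis of `CardyBoundaryCoulombGas.RectilinearCardy`). -/
def IsRectilinear (D : DobrushinDomain) : Prop :=
  ∃ S : Finset (ℂ × ℂ), (∀ p ∈ S, p.1.re = p.2.re ∨ p.1.im = p.2.im) ∧
    frontier D.carrier ⊆ ⋃ p ∈ S, segment ℝ p.1 p.2

/-- The Schwarz–Christoffel BOUNDARY WEIGHT of the window `W` seen through a chordal uniformizer
`φ : ℍ → D` (`φ(0) = a`, `φ(∞) = b`): `ν_φ(W) = ∫ π^{-1/3} |u|^{-1/3} |φ′(u)|^{2/3} du` over the real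
boundary parameters `u` with `φ(u) ∈ W ∩ (ba)` — the pull-back of `|Φ_D′(z)|^{1/3} |dz|`,
`Φ_D = π⁻¹ log ∘ φ⁻¹` the strip map, i.e. of `|dh_D|` for the SC primitive `h_D = ∫ (Φ_D′)^{1/3} dz`.
(`|φ′(u)|` is the speed of the real-variable boundary extension; for rectilinear polygons it is
real-analytic off the finitely many prevertices.) -/
def scWeight (D : DobrushinDomain) (φ : ConformalEquiv upperHalfPlaneSet D.carrier) (W : Set ℂ) : ℝ :=
  ∫ u in {u : ℝ | φ.boundaryExtension (u : ℂ) ∈ W ∩ D.arc 1},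
    Real.pi ^ (-(1 / 3 : ℝ)) * |u| ^ (-(1 / 3 : ℝ)) *
      ‖deriv (fun t : ℝ => φ.boundaryExtension (t : ℂ)) u‖ ^ ((2 : ℝ) / 3)

/-- KOEBE ENVELOPE at corner level for the family `Λ` of `D`: eventually in `δ`, for every corner
`(v,f)` of an inner face with `v` off the discrete arcs,
`‖F_δ(v,f)‖ ≤ C δ^{1/3} max(dist(δv, ∂D), δ)^{-1/3}` — the sharp boundary growth of `(Φ_D′)^{1/3}`
at the marks, generous at polygon corners, the interior bound `C_K δ^{1/3}` on compacts. -/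
def KEAt (D : DobrushinDomain) (Λ : ℝ → DiscreteDobrushin) : Prop :=
  ∃ C : ℝ, ∀ᶠ δ in 𝓝[>] (0:ℝ), ∀ v f : Site 2, IsCorner v f → (Λ δ).IsInnerFace f →
    v ∉ (Λ δ).zdArcA → v ∉ (Λ δ).zdArcB →
      ‖cornerObs (Λ δ) v f‖ ≤ C * δ ^ ((1:ℝ) / 3) *
        (max (Metric.infDist (meshPoint δ v) (frontier D.carrier)) δ) ^ (-(1 / 3 : ℝ))

/-- The crux's first hypothesis `WeakHolomorphy` AT the pair `(D, Λ)` (its text after the six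
family fields, verbatim). -/
def X1At (D : DobrushinDomain) (Λ : ℝ → DiscreteDobrushin) : Prop :=
  ∀ (φ : ℂ → ℂ), ContDiff ℝ (⊤ : ℕ∞) φ → HasCompactSupport φ → tsupport φ ⊆ D.carrier →
    Filter.Tendsto (fun δ : ℝ => ((δ ^ ((5:ℝ) / 3) : ℝ) : ℂ) * ∑ᶠ z : MedialVertex,
      (∫ ω, MedialPath.passageSum (medialExploration (Λ δ) ω) δ (1 / 3) z
        ∂(bondPercolation (zdGraph 2) half)) *
      ((fderiv ℝ φ (medialPoint δ z) 1 + Complex.I * fderiv ℝ φ (medialPoint δ z) Complex.I) / 2))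
      (nhdsWithin 0 (Set.Ioi 0)) (nhds 0)

/-- `WeakHolomorphy` yields `X1At` for every family (pure instantiation). -/
theorem x1At_of_weakHolomorphy (hW : WeakHolomorphy) {D : DobrushinDomain} {Λ : ℝ → DiscreteDobrushin}
    (hΛ : IsFamily D Λ) : X1At D Λ :=
  hW D Λ hΛ.1 hΛ.2.1 hΛ.2.2.1 hΛ.2.2.2.1 hΛ.2.2.2.2.1 hΛ.2.2.2.2.2

/-- WEAK HOLOMORPHY OF THE VERTEX POTENTIAL at `(D, Λ)`: the discrete `∂̄` of `H•` (whose increment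
along the lattice edge `v → v + e₀` through the face `f = v` is `F(v+e₀,f)τ(v+e₀,f) - F(v,f)τ(v,f)`,
and along `v → v + e₁` through the same face `F(v+e₁,f)τ - F(v,f)τ`), summed against compactly
supported smooth test functions, is `o(δ^{-5/3})`.  In the limit this is the Duffin relation
`f_B = (1 - i) f_A + i f_D` between the corner-class limits — the CORNER-level dual half of the
discrete Cauchy–Riemann equations; it makes subsequential limits of the potential holomorphic
(the VERTEX-level `WeakHolomorphy` only makes them complex-harmonic). -/
def PWHAt (D : DobrushinDomain) (Λ : ℝ → DiscreteDobrushin) : Prop :=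
  ∀ (φ : ℂ → ℂ), ContDiff ℝ (⊤ : ℕ∞) φ → HasCompactSupport φ → tsupport φ ⊆ D.carrier →
    Tendsto (fun δ : ℝ => ((δ ^ ((5:ℝ) / 3) : ℝ) : ℂ) * ∑ᶠ x : Site 2, φ (meshPoint δ x) *
      ((cornerObs (Λ δ) (x + e0) x * dir (x + e0) x - cornerObs (Λ δ) x x * dir x x) +
        (cornerObs (Λ δ) x (x - e0) * dir x (x - e0) -
          cornerObs (Λ δ) (x - e0) (x - e0) * dir (x - e0) (x - e0)) +
        Complex.I * ((cornerObs (Λ δ) (x + e1) x * dir (x + e1) x - cornerObs (Λ δ) x x * dir x x) +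
          (cornerObs (Λ δ) x (x - e1) * dir x (x - e1) -
            cornerObs (Λ δ) (x - e1) (x - e1) * dir (x - e1) (x - e1)))))
      (𝓝[>] (0:ℝ)) (𝓝 0)

/-- TOUCH-INTENSITY SHAPE LAW at the rectilinear Dobrushin polygon `P` along the family `Λ` — the
output of the fixed-domain identification, deliberately `c`-free: for every chordal uniformizer `φ`
and all open windows `W₁, W₂` away from the closed wired arc (hence from the marks) whose frontier
meets `∂P` in finitely many `φ`-parameters, (i) the normalised touch count `δ^{2/3} T_δ(W₁)` is
eventually bounded and (ii) the counts follow the SC boundary weight IN RATIO: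
`δ^{2/3} (T_δ(W₁) ν_φ(W₂) - T_δ(W₂) ν_φ(W₁)) → 0`.  No limit of the amplitude
`δ^{2/3} T_δ(W) / ν_φ(W)` is asserted (that would be an open amplitude theorem on `ℤ²`); along
subsequences it converges and cancels in every downstream martingale identity. -/
def TILShapeAt (P : DobrushinDomain) (Λ : ℝ → DiscreteDobrushin) : Prop :=
  ∀ (φ : ConformalEquiv upperHalfPlaneSet P.carrier), P.IsChordalUniformizing φ →
    ∀ W₁ W₂ : Set ℂ, IsOpen W₁ → IsOpen W₂ →
      Disjoint (closure W₁) (P.arc 0) → Disjoint (closure W₂) (P.arc 0) →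
      {u : ℝ | φ.boundaryExtension (u : ℂ) ∈ frontier W₁}.Finite →
      {u : ℝ | φ.boundaryExtension (u : ℂ) ∈ frontier W₂}.Finite →
      (∃ M : ℝ, ∀ᶠ δ in 𝓝[>] (0:ℝ), δ ^ ((2:ℝ) / 3) * touchCount (Λ δ) W₁ ≤ M) ∧
      Tendsto (fun δ : ℝ => δ ^ ((2:ℝ) / 3) *
          (touchCount (Λ δ) W₁ * scWeight P φ W₂ - touchCount (Λ δ) W₂ * scWeight P φ W₁))
        (𝓝[>] (0:ℝ)) (𝓝 0)

/-- NON-DEGENERACY of the touch counts at `(P, Λ)` (`N₀` in the crux pool, liminf form of the sharp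
half-plane one-arm bound, dressed by RSW gluing): every window of positive SC weight carries
`≍ δ^{-2/3}` expected touches, eventually. -/
def TouchLowerBoundAt (P : DobrushinDomain) (Λ : ℝ → DiscreteDobrushin) : Prop :=
  ∀ (φ : ConformalEquiv upperHalfPlaneSet P.carrier), P.IsChordalUniformizing φ →
    ∀ W : Set ℂ, IsOpen W → Disjoint (closure W) (P.arc 0) →
      {u : ℝ | φ.boundaryExtension (u : ℂ) ∈ frontier W}.Finite → 0 < scWeight P φ W →
      ∃ m > (0:ℝ), ∀ᶠ δ in 𝓝[>] (0:ℝ), m ≤ δ ^ ((2:ℝ) / 3) * touchCount (Λ δ) W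

/-- The conclusion of the crux, verbatim (= `Disproof.AllFamiliesSLE6`; `crux_unfold`). -/
def AllFamiliesSLE6 : Prop :=
  ∀ (D : DobrushinDomain) (Λ : ℝ → DiscreteDobrushin), (∀ δ, (Λ δ).Ω = D.carrier) →
    (∀ δ, (Λ δ).δ = δ) →
    Tendsto (fun δ : ℝ => Metric.hausdorffEDist (Λ δ).arcA (D.arc 0)) (𝓝[>] (0:ℝ)) (𝓝 0) →
    Tendsto (fun δ : ℝ => Metric.hausdorffEDist (Λ δ).arcB (D.arc 1)) (𝓝[>] (0:ℝ)) (𝓝 0) →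
    Tendsto (fun δ : ℝ => Metric.hausdorffEDist (medialPoint δ '' (Λ δ).zdABEdges) {D.pt 0, D.pt 1})
      (𝓝[>] (0:ℝ)) (𝓝 0) →
    (∀ᶠ δ in 𝓝[>] (0:ℝ), (Λ δ).IsZdAdmissible) →
    ConvergesInLawToSLE 6 D (Ωδ := fun _ => BondConfig (Site 2))
      (fun δ ω => CurveClass.mk
        (if dist (medialExplorationCurve (Λ δ) ω 0) (D.pt 0) ≤
            dist (medialExplorationCurve (Λ δ) ω 0) (D.pt 1)
          then (⟨medialExplorationCurve (Λ δ) ω⟩ : Curve ℂ)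
          else ⟨(medialExplorationCurve (Λ δ) ω).comp ⟨unitInterval.symm, unitInterval.continuous_symm⟩⟩))
      (fun _ => bondPercolation (zdGraph 2) half)

/-- The crux is literally `WeakHolomorphy → ParafermionPrecompact → AllFamiliesSLE6`. -/
theorem crux_unfold :
    ParafermionFamiliesToSLESix ↔ (WeakHolomorphy → ParafermionPrecompact → AllFamiliesSLE6) :=
  Iff.rfl

/-! ### Strip vocabulary for the Schwarz–Christoffel rigidity stub -/

/-- The open strip `{0 < Im w < 1}`. -/
def stripOpen : Set ℂ := {w : ℂ | 0 < w.im ∧ w.im < 1}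
/-- The closed strip `{0 ≤ Im w ≤ 1}`. -/
def stripClosed : Set ℂ := {w : ℂ | 0 ≤ w.im ∧ w.im ≤ 1}

/-- `x` and `y` lie in the same breakpoint-free segment of a boundary line (w.r.t. the finite set
of breakpoints `B`). -/
def SameSegment (B : Finset ℝ) (x y : ℝ) : Prop := ∀ b ∈ B, (x < b ↔ y < b)

/-- `h` is a BOUNDED holomorphic function on the open strip, continuous on the closed strip, whose
trace on each breakpoint-free segment of the bottom line (breakpoints `B₀`) moves MONOTONICALLY
along a line of direction `e^{iθ₀}` — `h(y) - h(x) ∈ e^{iθ₀(x)} [0, ∞)` for `x ≤ y` in the same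
segment — and likewise on the top line `ℝ + i` with `θ₁, B₁`.  (The shape of every subsequential
limit of the normalised potential `Ĥ_δ` transported to the strip: free arc = bottom, wired arc =
top, polygon corners = breakpoints, marks = the two ends.) -/
def IsSCTrace (θ₀ θ₁ : ℝ → ℝ) (B₀ B₁ : Finset ℝ) (h : ℂ → ℂ) : Prop :=
  DifferentiableOn ℂ h stripOpen ∧ ContinuousOn h stripClosed ∧
  (∃ M : ℝ, ∀ w ∈ stripClosed, ‖h w‖ ≤ M) ∧
  (∀ x y : ℝ, x ≤ y → SameSegment B₀ x y →
    (Complex.exp (-(θ₀ x : ℂ) * Complex.I) * (h y - h x)).im = 0 ∧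
    0 ≤ (Complex.exp (-(θ₀ x : ℂ) * Complex.I) * (h y - h x)).re) ∧
  (∀ x y : ℝ, x ≤ y → SameSegment B₁ x y →
    (Complex.exp (-(θ₁ x : ℂ) * Complex.I) * (h (y + Complex.I) - h (x + Complex.I))).im = 0 ∧
    0 ≤ (Complex.exp (-(θ₁ x : ℂ) * Complex.I) * (h (y + Complex.I) - h (x + Complex.I))).re)

/-! ## 1. The seven stub statements (named, so that the composition is readable) -/

/-- Statement of `stub_cornerFormStructure`. -/
def CornerFormStructure : Prop :=
  ∃ c : ℂ, (c = Complex.I ∨ c = -Complex.I) ∧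
    ∀ (D : DobrushinDomain) (Λ : ℝ → DiscreteDobrushin), IsFamily D Λ → ∀ᶠ δ in 𝓝[>] (0:ℝ),
      -- (a) exact closedness (DC 2012 Prop. 4) at inner HORIZONTAL medial vertices `{x, x+e₀}`
      (∀ x : Site 2, s(x, x + e0) ∈ (discreteDomainGraph (Λ δ).Ω (Λ δ).δ).edgeSet →
        x ∉ (Λ δ).zdArcA → x ∉ (Λ δ).zdArcB → x + e0 ∉ (Λ δ).zdArcA → x + e0 ∉ (Λ δ).zdArcB →
        cornerObs (Λ δ) x x - cornerObs (Λ δ) (x + e0) (x - e1) =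
          c * (cornerObs (Λ δ) (x + e0) x - cornerObs (Λ δ) x (x - e1))) ∧
      -- (a') the same at inner VERTICAL medial vertices `{x, x+e₁}`
      (∀ x : Site 2, s(x, x + e1) ∈ (discreteDomainGraph (Λ δ).Ω (Λ δ).δ).edgeSet →
        x ∉ (Λ δ).zdArcA → x ∉ (Λ δ).zdArcB → x + e1 ∉ (Λ δ).zdArcA → x + e1 ∉ (Λ δ).zdArcB →
        cornerObs (Λ δ) x x - cornerObs (Λ δ) (x + e1) (x - e0) =
          c * (cornerObs (Λ δ) x (x - e0) - cornerObs (Λ δ) (x + e1) x)) ∧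
      -- (b) darts whose vertex lies on the dual-wired arc are never traversed
      (∀ y f : Site 2, y ∈ (Λ δ).zdArcB → cornerObs (Λ δ) y f = 0) ∧
      -- (c) free-arc touch law (DC 2012 Prop. 5): deterministic phase = the all-open value,
      --     modulus = passage probability = `P[x ↔ A]`
      (∀ x y f : Site 2, s(x, y) ∈ (discreteDomainGraph (Λ δ).Ω (Λ δ).δ).edgeSet →
        y ∈ (Λ δ).zdArcB → x ∉ (Λ δ).zdArcA → x ∉ (Λ δ).zdArcB →
        (Λ δ).IsInnerFace f → IsCorner x f → IsCorner y f →
        cornerObs (Λ δ) x f = openPhase (Λ δ) x f * (connA (Λ δ) x : ℂ) ∧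
          dartProb (Λ δ) x f = connA (Λ δ) x ∧ ‖openPhase (Λ δ) x f‖ ≤ 1 ∧
          (0 < connA (Λ δ) x → ‖openPhase (Λ δ) x f‖ = 1)) ∧
      -- (d) wired-arc law (dual of (c)): deterministic phase = the all-closed value
      (∀ y y' f : Site 2, s(y, y') ∈ (discreteDomainGraph (Λ δ).Ω (Λ δ).δ).edgeSet →
        y ∈ (Λ δ).zdArcA → y' ∈ (Λ δ).zdArcA → (Λ δ).IsInnerFace f → IsCorner y f → IsCorner y' f →
        (∀ f' : Site 2, (Λ δ).IsInnerFace f' → IsCorner y f' → IsCorner y' f' → f' = f) →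
        cornerObs (Λ δ) y f = closedPhase (Λ δ) y f * (dartProb (Λ δ) y f : ℂ) ∧
          ‖closedPhase (Λ δ) y f‖ ≤ 1 ∧ (0 < dartProb (Λ δ) y f → ‖closedPhase (Λ δ) y f‖ = 1))

/-- Statement of `stub_scRigidity`. -/
def SCRigidity : Prop :=
  ∀ (θ₀ θ₁ : ℝ → ℝ) (B₀ B₁ : Finset ℝ) (g h : ℂ → ℂ),
    (∀ x y : ℝ, SameSegment B₀ x y → θ₀ x = θ₀ y) → (∀ x y : ℝ, SameSegment B₁ x y → θ₁ x = θ₁ y) →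
    IsSCTrace θ₀ θ₁ B₀ B₁ g → IsSCTrace θ₀ θ₁ B₀ B₁ h →
    -- the reference solution `g` is non-degenerate: Schwarz–Christoffel structure
    (∀ w ∈ stripOpen, deriv g w ≠ 0) →
    (∀ b ∈ B₀, ∃ β : ℝ, -1 < β ∧ β < 1 ∧ ∃ r > (0:ℝ), ∃ ψ : ℂ → ℂ,
      DifferentiableOn ℂ ψ (Metric.ball (b : ℂ) r) ∧ ψ b ≠ 0 ∧
      ∀ w ∈ Metric.ball (b : ℂ) r ∩ stripOpen, deriv g w = (w - b) ^ (-(β : ℂ)) * ψ w) →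
    (∀ b ∈ B₁, ∃ β : ℝ, -1 < β ∧ β < 1 ∧ ∃ r > (0:ℝ), ∃ ψ : ℂ → ℂ,
      DifferentiableOn ℂ ψ (Metric.ball ((b : ℂ) + Complex.I) r) ∧ ψ ((b : ℂ) + Complex.I) ≠ 0 ∧
      ∀ w ∈ Metric.ball ((b : ℂ) + Complex.I) r ∩ stripOpen,
        deriv g w = ((b : ℂ) + Complex.I - w) ^ (-(β : ℂ)) * ψ w) →
    (∃ ν ∈ Set.Ioc (0:ℝ) Real.pi,
      (∀ x : ℝ, (∀ b ∈ B₀, x < b) → (∀ b ∈ B₁, x < b) → ∃ n : ℤ, ν = θ₁ x - θ₀ x + n * Real.pi) ∧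
      ∃ c > (0:ℝ), ∃ R : ℝ, ∀ w ∈ stripOpen, w.re ≤ -R → c * Real.exp (ν * w.re) ≤ ‖deriv g w‖) →
    (∃ ν ∈ Set.Ioc (0:ℝ) Real.pi,
      (∀ x : ℝ, (∀ b ∈ B₀, b < x) → (∀ b ∈ B₁, b < x) → ∃ n : ℤ, ν = θ₀ x - θ₁ x + n * Real.pi) ∧
      ∃ c > (0:ℝ), ∃ R : ℝ, ∀ w ∈ stripOpen, R ≤ w.re → c * Real.exp (-(ν * w.re)) ≤ ‖deriv g w‖) →
    ∃ c : ℝ, 0 ≤ c ∧ ∃ k : ℂ, ∀ w ∈ stripClosed, h w = c * g w + k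

/-- Statement of `stub_koebeEnvelope`. -/
def KoebeEnvelope : Prop :=
  ∀ (D : DobrushinDomain) (Λ : ℝ → DiscreteDobrushin), IsFamily D Λ →
    ParafermionPrecompactRepairedAt D Λ → KEAt D Λ

/-- Statement of `stub_antiholomorphicDefect`. -/
def AntiholomorphicDefect : Prop :=
  CornerFormStructure →
    ∀ (D : DobrushinDomain) (Λ : ℝ → DiscreteDobrushin), IsFamily D Λ → KEAt D Λ → X1At D Λ → PWHAt D Λ

/-- Statement of `stub_traceIdentification`. -/
def TraceIdentification : Prop :=
  CornerFormStructure → SCRigidity →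
    ∀ (P : DobrushinDomain), IsRectilinear P → ∀ (Λ : ℝ → DiscreteDobrushin), IsFamily P Λ →
      KEAt P Λ → PWHAt P Λ → TILShapeAt P Λ

/-- Statement of `stub_touchLowerBound`. -/
def TouchLowerBound : Prop :=
  ∀ (P : DobrushinDomain), IsRectilinear P → ∀ (Λ : ℝ → DiscreteDobrushin), IsFamily P Λ →
    TouchLowerBoundAt P Λ

/-- Statement of `stub_touchIntensityToSLE`. -/
def TouchIntensityToSLE : Prop :=
  (∀ (P : DobrushinDomain), IsRectilinear P → ∀ (Λ : ℝ → DiscreteDobrushin), IsFamily P Λ →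
      TILShapeAt P Λ ∧ TouchLowerBoundAt P Λ) → AllFamiliesSLE6

/-! ## 2. The registered stubs

Each stub's type is the NAMED statement of §1 (full text there), so that the hypotheses of the
composition `allFamiliesSLE6_of_stubs` are the declared stub statements by name. -/

/-- **stub_cornerFormStructure (lattice, size M/L, provable now) — DC 2012 Prop. 4 + Prop. 5 for the
tree's `q = 1` corner observable.**  There is a universal coefficient `c ∈ {i, -i}` (the chirality
of the tree's winding convention, hedged) such that for every Dobrushin domain and admissible
family, eventually in `δ`: (a) at every inner medial vertex (an edge of `Ω_δ` with no endpoint on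
the discrete arcs; both its faces are then inner, `IsZdAdmissible.arcs_cover_faceBoundary`) the
four corner observables obey `F_A - F_C = c (F_B - F_D)` (`A=(x,x), B=(x+e₀,x), C=(x+e₀,x-e₁),
D=(x,x-e₁)` at the horizontal edge `{x,x+e₀}`, resp. `A=(x,x), D=(x+e₁,x), B=(x,x-e₀),
C=(x+e₁,x-e₀)` at `{x,x+e₁}`) — Duminil-Copin's pairing `ω ↔ ω △ {e}` at `p = 1/2`, spin `1/3`,
equivalently the corner flow `F·τ` is divergence-free; (b) no dart with vertex on the dual-wired
arc is ever traversed (its vertex has no bc-open edge; FK analogue `cornerOrbit_fst_not_mem_zdArcB`);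
(c) at a free-arc boundary dart `(x,f)` (`y ∈ B`, `x` off the arcs, `f ∋ x,y` inner) the passage
happens iff `x ↔ A`, at most once, with the winding of the ALL-OPEN exploration path (the path
cannot wind around a boundary point: Hopf's Umlaufsatz on the closed-up prefix, tree template
`FreeArcPhase.turnCount_eq_zero_or_eight` with the orientation resolved), so
`F(x,f) = openPhase · P[x ↔ A]`; (d) dually on wired boundary edges with the ALL-CLOSED path.
Why plausibly true: printed (DC 2012 Props. 4–5, DCS 2012 Prop. 8.6) and the FK-Ising twin of every
clause is a theorem of the tree (`DartFlux.lean`, `FKFreeArcPhase.lean`).  Leans on: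
`isMedialExploration_medialExploration_holds`, `IsMedialExploration.turn/start/nodup`,
`medialCycle_turning_holds`, `IsSimplePolygon.sum_extAngle_eq`, `ExplorationWinding`. [size M/L] -/
theorem stub_cornerFormStructure : CornerFormStructure := by
  sorry

/-- **stub_scRigidity (pure complex analysis over Mathlib, size M–L, provable now) —
Schwarz–Christoffel rigidity with monotone traces, strip form with breakpoints.**  Two bounded
holomorphic functions `g, h` on the strip with continuous boundary values whose traces move
monotonically along lines of the SAME piecewise-constant directions (`IsSCTrace`), `g` being a
non-degenerate SC-type solution (no critical point inside; local form `g′ = (w-b)^{-β} ψ`,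
`β ∈ (-1,1)`, `ψ(b) ≠ 0` at each breakpoint; MINIMAL admissible exponential rate at both ends —
the rate `ν ∈ (0, π]` congruent mod `π` to the direction jump, below which no homogeneous mode
`e^{νw} v` fits both end lines), satisfy `h = c·g + k` with `c ≥ 0` REAL.  Proof sketch (checked by
hand, triage r1-1/2/3 for the breakpoint-free instance): `q := h′/g′` is invariant under the
Schwarz reflection in EVERY boundary segment (both derivatives pick up the same phase), hence
extends to a `2i`-periodic holomorphic function `Q(e^{πw})` on `ℂ*` minus breakpoint images, real
`≥ 0` on the axis; at a breakpoint `Z := (h - h(b))/(g - g(b))` is reflection-invariant with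
`|Z| ≲ |w-b|^{β-1}`, `β - 1 > -2`, and `≥ 0` on both sides, so `Z` and then `q = Z + Z′(g-g(b))/g′`
are holomorphic at `b`; boundedness of `h` and the quasi-periodicity `h(w+2i) = e^{2iΔ} h(w) + t` at
each end give `|h′| ≲ e^{ν_h |x|}`-decay with `ν_h ≥ ν`, so `q` is bounded at both ends of `ℂ*`,
hence constant; `c ≥ 0` from the common orientation.  Sharpness: `z + ε sinh 2πz` (growth),
`2 sinh πz` (opposite monotonicity) — both excluded by `IsSCTrace`.  Leans on: Mathlib complex
analysis (`Complex.differentiableOn_*`, removable singularities `Complex.differentiableOn_update_limUnder_of_bddAbove`,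
Liouville / Laurent on `ℂ*`), Schwarz reflection to be assembled (Morera: `Complex.differentiableOn_of_*`). [size M–L] -/
theorem stub_scRigidity : SCRigidity := by
  sorry

/-- **stub_koebeEnvelope (percolation estimate, size XL; the shared hardest input of the whole crux
pool, `KE`) — the Koebe envelope at CORNER level.**  For every Dobrushin domain and admissible
family satisfying the crux's (edge-guarded, landed-weakening) second hypothesis, the corner
observable obeys `‖F_δ(v,f)‖ ≤ C δ^{1/3} max(dist(δv,∂D), δ)^{-1/3}` at every corner of an inner
face off the arcs, eventually in `δ`.  Content: the `δ^{1/12}` winding-phase cancellation beyond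
the polychromatic two-arm bound `P(dart ∈ γ) ≲ (δ/d)^{1/4}`, UNIFORMLY down to the boundary collar
(heights `[δ^{1/13}, η]`, crux NOTES S2) and near the marks (growth `d^{-1/3}` = the SC rate of
`(Φ′)^{1/3}` at the strip ends; `o(d^{-7/3})` would already suffice for uniqueness, triage r1-3).
Stated at corner level because vertex bounds do not control the staggered corner modes (triage
r1-1 (1), r1-2 (b)); the potential tolerates those modes (they contribute `O(δ)` to `Ĥ_δ`) but the
envelope is what makes `Ĥ_δ` uniformly `2/3`-Hölder up to `∂D` (Arzelà–Ascoli incl. traces) and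
bounds the trace variation through the flux identity.  Why it might fail: it is the sharp one-arm
rate on `ℤ²`; nothing weaker than the exponent `1/3` in the collar keeps the trace variation
bounded.  Leans on: `ClauseBoundEdges` (hypothesis), RSW inputs of the tree
(`annulusOpenCrossing_half_le_holds`, `Nolin2008_halfPlane_twoArm_holds` is site-𝕋 only — port). [size XL] -/
theorem stub_koebeEnvelope : KoebeEnvelope := by
  sorry

/-- **stub_antiholomorphicDefect (size XL / open; the corner-level dual Cauchy–Riemann half) — from
the crux's VERTEX-level weak holomorphy to weak holomorphy of the vertex POTENTIAL.**  Given the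
exact closedness of `stub_cornerFormStructure` and the envelope, every subsequential limit of
`Ĥ_δ` is `h = H₁ + conj H₂` (complex-harmonic) and `X1At` (weak `∂̄` of the vertex observable
`s ∝ Σ_X f_X = const · H₁′`) sees only `H₁`; this stub kills the antiholomorphic defect `H₂`:
tested against `C_c^∞` functions, the discrete `∂̄` of `H•` is `o(δ^{-5/3})` (`PWHAt`), i.e. the
Duffin relation `f_B = (1-i) f_A + i f_D` holds in the limit.  Two plausible proofs: (α) the route's
own mechanism for `WeakHolomorphy` (SUSY Ward identity / `QExactPlaquette`, "Q-exactness of the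
dual plaquette circulation") is plaquette-level and should give the corner relation directly;
(β) closedness + `X1At` force `g := ∂̄h` antiholomorphic, and the explicit free-arc structure (c)
pins the boundary values of the corner classes, so `g → 0` at the free arc and an antiholomorphic
function vanishing on an arc vanishes.  Why it might fail: the corner classes may converge to a
NON-coherent limit (CardyComplexCone's rank-2 crux `EdgeCoherence`, stmt-11385, is open): then the
potential's limit is harmonic, SC rigidity is void, and every potential-based line dies here while
the vertex-observable route (Morera on `s`) survives — this stub is exactly the delta between the
two.  Leans on: `CornerFormStructure` (hyp), `KEAt` (hyp), `X1At` (hyp);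
`HalfCRKernel.faceKernel/vertexKernel` show which discrete modes are invisible. [size XL] -/
theorem stub_antiholomorphicDefect : AntiholomorphicDefect := by
  sorry

/-- **stub_traceIdentification (the LOAD-BEARING lever of the line, size XL) — fixed-polygon
identification by potential + Helly + Schwarz–Christoffel rigidity.**  For a rectilinear Dobrushin
polygon `P` and an admissible family: build the face potential `(H•, H∘)` of the corner flow on the
inner faces of `Ω_δ` minus the frozen `B`-sites (single-valued: closedness (a) at inner medial
vertices, chains — no cycles — at boundary medial vertices; discrete Poincaré lemma
`exists_potential_of_isFaceShelling` + shellability of the Jordan face domain); `Ĥ_δ := δ^{2/3}H_δ`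
is uniformly bounded and `2/3`-Hölder up to `∂P` by the envelope (flux identity: trace variation
over a side = lid flux + two collar transversals), so precompact in `C(P̄)` (Arzelà–Ascoli) with
traces of bounded variation (Helly); by (c)/(d) the trace on each straight run of the free (wired)
arc is collinear and monotone with a run-wise constant direction read off `openPhase`
(`closedPhase`) of the explicit boundary-hugging paths; every subsequential limit is holomorphic
(`PWHAt`, Weyl) and, transported by the strip map of `P`, an `IsSCTrace` with the polygon's
prevertices as breakpoints; `stub_scRigidity` against the explicit SC reference
`g = ∫ (Φ_P′)^{1/3} dz ∘ Φ_P⁻¹` gives `h = c_seq · g + k`, `c_seq ≥ 0`; trace increments over windows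
are then `c_seq ν_φ(W) + o(1)`, whence boundedness and the RATIO law `TILShapeAt` along the full
family (ratios do not see `c_seq`).  Why it might fail: only through its inputs — with `KEAt` false
near the marks the traces need not be bounded; with `PWHAt` false the limit is harmonic and rigid
identification is impossible (examples: Poisson extensions of `arctan`).  Leans on:
`CornerFormStructure`, `SCRigidity`, `KEAt`, `PWHAt` (hyps); tree: `CornerPotential.lean`
(`IsCornerClosedOn`, `exists_potential_of_isFaceShelling`), `ConformalEquiv.boundaryExtension`,
`MarkedDomain.IsChordalUniformizing`, `exists_frontier_near_of_mem_zdBoundary₀`; Mathlib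
Arzelà–Ascoli (`BoundedContinuousFunction.arzela_ascoli`), Helly/monotone limits, Weyl/Morera for
uniform limits (`TendstoLocallyUniformlyOn.differentiableOn`); SC asymptotics of the strip map at
polygon corners (Carathéodory + reflection; to be built). [size XL] -/
theorem stub_traceIdentification : TraceIdentification := by
  sorry

/-- **stub_touchLowerBound (size XL / open; `N₀` of the crux pool) — windows of positive SC weight
carry `≍ δ^{-2/3}` touches.**  For a site `x` on a flat free side at macroscopic distance from the
wired arc, `P[x ↔ A] ≥ P[half-plane one-arm from x to distance L] × (RSW gluing) ≥ c′ (δ/L)^{1/3}`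
GIVEN the sharp liminf one-arm bound `liminf_n n^{1/3} π₁⁺(n) > 0` on bond-`ℤ²` (⊋ the log form
`CardyBoundaryCoulombGas.HalfPlaneOneArmThird`, stmt-5662; numerically `u(N/2)·N^{1/3} = 0.98–1.02`,
MC j009926 on the item); summing over the `≍ |W|/δ` sites of the window gives `m δ^{-2/3}`.  Why it
might fail: the one-arm exponent `1/3` on `ℤ²` is open (only `HalfPlaneOneArmSqrtBound`, exponent
`1/2`, is in the tree); an SLE₆ limit forces it only in log form (Smirnov–Werner), so the liminf form
is a genuine extra bet (triage r1-2 (a)).  Leans on: tree RSW (`annulusOpenCrossing_half_le_holds`,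
`JordanDomain.exists_forall_mem_meshDomain_and_reachable`), FKG/`isUpperSet_openConnIn`;
sibling crux 5662's lines (`ip-passage-stirling`, qKZ strip) for the one-arm input. [size XL] -/
theorem stub_touchLowerBound : TouchLowerBound := by
  sorry

/-- **stub_touchIntensityToSLE (size XL; the DELEGATED dynamic step = Transfer of the sister cards
`six-arm-collar-compensator` ≈ `free-arc-touch-covariance-martingale`) — touch-intensity shape law
+ non-degeneracy on all rectilinear polygons ⇒ SLE₆ for every domain and family.**  For a Jordan
`D` and family `Λ`: precompactness of the interface laws and Loewner regularity of subsequential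
limits (Aizenman–Burchard / Kemppainen–Smirnov Condition G2 from RSW, known for bond-`ℤ²`); the
touch count of a far free-arc window is an exact Doob martingale of the exploration
(`{v ↔_{Ω_t} A_t} = {v ↔_Ω A}`: left chain of the path is bc-open to `A`); its conditional value is
the touch count of the SLIT domain, sandwiched between inner/outer rectilinear polygons by
monotonicity of `x ↔ A` in the domain and RSW-continuity in the carrier (six-arm collar lemma,
soft half-plane three-arm modulus), where the hypothesis identifies it with `c ν(W)` up to the
ratio-free constant; locality (common germ at `b`) makes the constant exploration-independent; in
`ℍ`-coordinates `ν_{D_t}` has density `h_t(y) = g_t′(y)^{1/3}(g_t(y) - W_t)^{-1/3}` times a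
`t`-independent weight, whose martingale property forces `W = √6 B` (Itô drift `-4/3 + 2κ/9`,
far-field coefficients `W`, `W² - 6t`; Lévy); the SLE₆ curve object is the proved
`exists_isSLECurve_six`, uniqueness in law `IsSLELaw.unique`, measurability of the family interface
a cylinder statement.  Why it might fail: carrier-uniformity at boundary-touching times of the
exploration (tip boxes with four arms at a random location), existence of admissible families for
the auxiliary polygons (`DiscretisationFamilyExists`, stmt-9644), and Camia–Newman generality of
`D`.  Leans on: `TILShapeAt`, `TouchLowerBoundAt` (hyps); tree: `ChordalKSCondition`,
`CurveTightness`, `levy_characterisation_holds`, `exists_isSLECurve_six`,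
`isSLELaw_of_isLocalMartingale_driving_through`, `Loewner.martingale_driver_of_fkObservable`
(exponent-`1/2` template for the `1/3` computation), `ZdFiveArmCounting`,
`LawlerSchrammWerner2002_halfPlane_threeArm` (site-𝕋: port). [size XL] -/
theorem stub_touchIntensityToSLE : TouchIntensityToSLE := by
  sorry

/-! ## 3. Composition (sorry-free): the stubs conclude the crux BY NAME -/

/-- **Arrow-form composition** `S1 → … → S7 → (WeakHolomorphy → ParafermionPrecompact →
AllFamiliesSLE6)` (the crux unfolded, `crux_unfold`).  Pure logic: the dynamic stub needs the shape
law and the lower bound on every rectilinear polygon along every admissible family; the shape law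
comes from the identification stub fed with the lattice structure, the rigidity lemma, the
envelope (from the crux's second hypothesis through its landed edge-guarded weakening
`repaired_of_parafermionPrecompact`) and the potential's weak holomorphy (from the crux's first
hypothesis through the defect stub).  No stub restates the crux; the vacuous branch of the typed
crux (`Disproof.crux_of_not_vanishing`) is not used. -/
theorem allFamiliesSLE6_of_stubs (h₁ : CornerFormStructure) (h₂ : SCRigidity)
    (h₃ : KoebeEnvelope) (h₄ : AntiholomorphicDefect) (h₅ : TraceIdentification)
    (h₆ : TouchLowerBound) (h₇ : TouchIntensityToSLE) :
    WeakHolomorphy → ParafermionPrecompact → AllFamiliesSLE6 := by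
  intro hW hP
  exact h₇ (fun P hPr Λ hΛ =>
    ⟨h₅ h₁ h₂ P hPr Λ hΛ (h₃ P Λ hΛ (repaired_of_parafermionPrecompact hP P Λ))
        (h₄ h₁ P Λ hΛ (h₃ P Λ hΛ (repaired_of_parafermionPrecompact hP P Λ))
          (x1At_of_weakHolomorphy hW hΛ)),
      h₆ P hPr Λ hΛ⟩)

/-- **The skeleton theorem: the line concludes the crux BY NAME.**  The seven registered stubs
(the only `sorry`s of the file) fed into the sorry-free composition `allFamiliesSLE6_of_stubs`;
`#print axioms` shows `sorryAx` exactly through the seven `stub_*` declarations, and as they are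
proved this theorem becomes the crux proof. -/
theorem ParafermionFamiliesToSLESix_of :
    Summit.CriticalPhenomena.CardyFormulaZ2.Theses.CardySusyWard.ParafermionFamiliesToSLESix :=
  allFamiliesSLE6_of_stubs stub_cornerFormStructure stub_scRigidity stub_koebeEnvelope
    stub_antiholomorphicDefect stub_traceIdentification stub_touchLowerBound stub_touchIntensityToSLE

end Summit.CriticalPhenomena.CardyFormulaZ2.Cruxes.ParafermionFamiliesToSLESix.ExactPotentialSchwarzChristoffel

end
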